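import Mathlib

/-!
# Crux `NewtonUnitEquations.DissociatedUniform` (stmt-ValiantsHypothesis-5905), line `greedy-basis-shadow` —
stub `stub_exposedGenericDirection` (stub A): exposed generic direction

Pure planar convex geometry.  Every extreme point `e` of the convex hull in `ℝ²` of a finite set of lattice points
`S ⊆ ℕ²` (embedded by `e ↦ (i ↦ (e i : ℝ))`) is the image of some `e₀ ∈ S` which is the STRICT maximiser over `S` of a
linear height `s ↦ ∑ i, w i * (s i : ℝ)`, and the direction `w` can moreover be chosen so that this height is injective
on any prescribed finite set `T ⊆ ℕ²`.

Proof.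
* `extremePoints_convexHull_subset` gives `e = emb e₀` with `e₀ ∈ S`.
* An extreme point of a convex set is not in the convex hull of the other points
  (`Convex.mem_extremePoints_iff_mem_sdiff_convexHull_sdiff`), so `e ∉ convexHull (emb '' S \ {e})`; this hull is compact
  (finite set), hence closed, and the Hahn–Banach separation theorem `geometric_hahn_banach_closed_point` gives a
  continuous linear functional strictly exposing `e`, i.e. a direction `w₀` (`strongDual_apply_eq_sum_two`) with
  `height w₀ s < height w₀ e₀` for all `s ∈ S`, `s ≠ e₀` (`mem_and_exists_strict_height_of_mem_extremePoints`).
* Genericity: put `w = w₀ + ε • u` with `u = (1, M)`.  For `p ≠ q` in `T` the function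
  `M ↦ (p 0 - q 0) + M * (p 1 - q 1)` is affine and not identically zero, so along `atTop` it is eventually non-zero
  (`eventually_affine_ne_zero`); `T × T` being finite, some `M` works for all pairs.  Then every requirement on `ε`
  (the finitely many strict inequalities, open conditions true at `ε = 0`; the finitely many non-vanishings
  `⟪w₀ + ε u, p - q⟫ ≠ 0`, affine in `ε` with non-zero slope) holds eventually along the punctured neighbourhood filter
  `𝓝[≠] 0` of `ℝ`, which is non-trivial, so a good `ε` exists.

No named facts, no citations: everything is folklore planar convex geometry over Mathlib.
-/

noncomputable section

-- Sub = Summit single-conjunct layout: the duplicated namespace component is mandated by the tree.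
set_option linter.dupNamespace false

open scoped BigOperators Topology

namespace Summit.ValiantsHypothesis.ValiantsHypothesis.Theorems.NewtonUnitEquationsDissociatedUniform

/-- An affine function `x ↦ a + x * b` of one real variable which is not identically zero (`b = 0 → a ≠ 0`) is
eventually non-zero along any filter that eventually avoids every single point (e.g. `atTop`, or a punctured
neighbourhood filter): it has at most one zero. [folklore] -/
theorem eventually_affine_ne_zero {l : Filter ℝ} (hl : ∀ c : ℝ, ∀ᶠ x in l, x ≠ c) {a b : ℝ}
    (hab : b = 0 → a ≠ 0) : ∀ᶠ x in l, a + x * b ≠ 0 := by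
  by_cases hb : b = 0
  · exact Filter.Eventually.of_forall fun x => by simpa [hb] using hab hb
  · refine (hl (-a / b)).mono fun x hx h => hx ?_
    rw [eq_div_iff hb]
    linarith

/-- The punctured neighbourhood filter `𝓝[≠] 0` of `ℝ` eventually avoids every single point `c`
(for `c = 0` by definition, for `c ≠ 0` because `{c}ᶜ` is a neighbourhood of `0`). [folklore] -/
theorem eventually_ne_nhdsNE_zero (c : ℝ) : ∀ᶠ x in 𝓝[≠] (0 : ℝ), x ≠ c := by
  rcases eq_or_ne c 0 with rfl | hc
  · exact eventually_mem_nhdsWithin.mono fun x hx => hx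
  · exact mem_nhdsWithin_of_mem_nhds (isOpen_ne.mem_nhds hc.symm)

/-- A continuous linear functional `f` on `ℝ²` is the height `y ↦ ∑ i, w i * y i` in the direction `w` of its values
on the standard basis vectors. [folklore] -/
theorem strongDual_apply_eq_sum_two (f : StrongDual ℝ (Fin 2 → ℝ)) (y : Fin 2 → ℝ) :
    f y = ∑ i, (f fun j => if i = j then 1 else 0) * y i := by
  have h := (f : (Fin 2 → ℝ) →ₗ[ℝ] ℝ).pi_apply_eq_sum_univ y
  simp only [ContinuousLinearMap.coe_coe, smul_eq_mul] at h
  rw [h]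
  exact Finset.sum_congr rfl fun i _ => mul_comm _ _

/-- **Strictly exposing direction.**  An extreme point `x` of the convex hull of a finite set `P ⊆ ℝ²` belongs to `P`
and is the strict maximiser over `P` of some linear height `y ↦ ∑ i, w i * y i`: `x` is not in the (compact, convex)
hull of `P \ {x}`, from which it is strictly separated by Hahn–Banach. [folklore] -/
theorem mem_and_exists_strict_height_of_mem_extremePoints {P : Set (Fin 2 → ℝ)} (hP : P.Finite)
    {x : Fin 2 → ℝ} (hx : x ∈ Set.extremePoints ℝ (convexHull ℝ P)) :
    x ∈ P ∧ ∃ w : Fin 2 → ℝ, ∀ y ∈ P, y ≠ x → ∑ i, w i * y i < ∑ i, w i * x i := by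
  refine ⟨extremePoints_convexHull_subset hx, ?_⟩
  -- `x` is not in the convex hull of the other points
  have hx' := ((convex_convexHull ℝ P).mem_extremePoints_iff_mem_sdiff_convexHull_sdiff).1 hx
  have hsub : P \ {x} ⊆ convexHull ℝ P \ {x} := Set.sdiff_subset_sdiff_left (subset_convexHull ℝ P)
  have hnot : x ∉ convexHull ℝ (P \ {x}) := fun h => hx'.2 (convexHull_mono hsub h)
  -- separate `x` strictly from the closed convex hull of the other points
  obtain ⟨f, t, hfK, hfx⟩ :=
    geometric_hahn_banach_closed_point (convex_convexHull ℝ (P \ {x}))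
      (hP.sdiff.isClosed_convexHull (𝕜 := ℝ)) hnot
  refine ⟨fun i => f fun j => if i = j then 1 else 0, fun y hy hyx => ?_⟩
  have hlt : f y < f x := (hfK y (subset_convexHull ℝ _ ⟨hy, hyx⟩)).trans hfx
  rwa [strongDual_apply_eq_sum_two f y, strongDual_apply_eq_sum_two f x] at hlt

/-- **Stub A of line `greedy-basis-shadow` (exposed generic direction), registered signature.**  For finite
`S T ⊆ ℕ²` and an extreme point `e` of the convex hull of the real embedding of `S`, there are a direction `w : ℝ²`
and `e₀ ∈ S` embedding to `e` such that `e₀` is the strict maximiser over `S` of the height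
`s ↦ ∑ i, w i * (s i : ℝ)` and this height is injective on `T`.  The strictly exposing direction `w₀` of
`mem_and_exists_strict_height_of_mem_extremePoints` is perturbed to `w₀ + ε • (1, M)` with `M` separating `T` and
`ε ≠ 0` small and off a finite set (filter argument along `atTop` and `𝓝[≠] 0`). [folklore] -/
theorem stub_exposedGenericDirection (S T : Finset (Fin 2 →₀ ℕ)) (e : Fin 2 → ℝ)
    (he : e ∈ Set.extremePoints ℝ
      (convexHull ℝ ((fun e : Fin 2 →₀ ℕ => fun i : Fin 2 => ((e i : ℕ) : ℝ)) '' (S : Set (Fin 2 →₀ ℕ))))) :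
    ∃ (w : Fin 2 → ℝ) (e₀ : Fin 2 →₀ ℕ), e₀ ∈ S ∧ (fun i : Fin 2 => ((e₀ i : ℕ) : ℝ)) = e ∧
      (∀ s ∈ S, s ≠ e₀ → (∑ i, w i * ((s i : ℕ) : ℝ)) < ∑ i, w i * ((e₀ i : ℕ) : ℝ)) ∧
      Set.InjOn (fun e : Fin 2 →₀ ℕ => ∑ i, w i * ((e i : ℕ) : ℝ)) (T : Set (Fin 2 →₀ ℕ)) := by
  classical
  -- the embedding `ℕ² → ℝ²` is injective
  have hinj : Function.Injective (fun e : Fin 2 →₀ ℕ => fun i : Fin 2 => ((e i : ℕ) : ℝ)) := by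
    intro p q hpq
    ext i
    have h := congr_fun hpq i
    dsimp only at h
    exact_mod_cast h
  -- Steps 1–3: the extreme point is `emb e₀`, strictly exposed by a direction `w₀`
  obtain ⟨hemem, w₀, hw₀⟩ :=
    mem_and_exists_strict_height_of_mem_extremePoints (S.finite_toSet.image _) he
  obtain ⟨e₀, he₀S, rfl⟩ := hemem
  have he₀S' : e₀ ∈ S := Finset.mem_coe.1 he₀S
  have hstrict : ∀ s ∈ S, s ≠ e₀ →
      ∑ i, w₀ i * ((s i : ℕ) : ℝ) < ∑ i, w₀ i * ((e₀ i : ℕ) : ℝ) := fun s hs hse =>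
    hw₀ _ ⟨s, Finset.mem_coe.2 hs, rfl⟩ fun h => hse (hinj h)
  -- Step 4a: a slope `M` such that the height in direction `u = (1, M)` separates the points of `T`
  obtain ⟨M, hM⟩ : ∃ M : ℝ, ∀ p ∈ T, ∀ q ∈ T, p ≠ q →
      (((p 0 : ℕ) : ℝ) - ((q 0 : ℕ) : ℝ)) + M * (((p 1 : ℕ) : ℝ) - ((q 1 : ℕ) : ℝ)) ≠ 0 := by
    suffices h : ∀ᶠ M in Filter.atTop, ∀ p ∈ T, ∀ q ∈ T, p ≠ q →
        (((p 0 : ℕ) : ℝ) - ((q 0 : ℕ) : ℝ)) + M * (((p 1 : ℕ) : ℝ) - ((q 1 : ℕ) : ℝ)) ≠ 0 from h.exists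
    simp only [Filter.eventually_all_finset, Filter.eventually_imp_distrib_left]
    intro p _ q _ hpq
    refine eventually_affine_ne_zero Filter.eventually_ne_atTop fun h1 h0 => hpq ?_
    exact Finsupp.ext (Fin.forall_fin_two.2
      ⟨by exact_mod_cast sub_eq_zero.1 h0, by exact_mod_cast sub_eq_zero.1 h1⟩)
  obtain ⟨u, hu⟩ : ∃ u : Fin 2 → ℝ, ∀ x : Fin 2 → ℝ, ∑ i, u i * x i = x 0 + M * x 1 :=
    ⟨![1, M], fun x => by simp [Fin.sum_univ_two]⟩
  -- heights in the perturbed direction `w₀ + ε • u` are affine in `ε`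
  have hdecomp : ∀ (ε : ℝ) (x : Fin 2 → ℝ),
      ∑ i, (w₀ i + ε * u i) * x i = ∑ i, w₀ i * x i + ε * ∑ i, u i * x i := by
    intro ε x
    simp only [Fin.sum_univ_two]
    ring
  -- Step 4b: every requirement holds for all small `ε ≠ 0` off a finite set
  have h1 : ∀ s ∈ S, s ≠ e₀ → ∀ᶠ ε in 𝓝[≠] (0 : ℝ),
      ∑ i, (w₀ i + ε * u i) * ((s i : ℕ) : ℝ) < ∑ i, (w₀ i + ε * u i) * ((e₀ i : ℕ) : ℝ) := by
    intro s hs hse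
    have hc : ∀ x : Fin 2 → ℝ, Continuous fun ε : ℝ => ∑ i, (w₀ i + ε * u i) * x i := fun x => by
      simp only [hdecomp]
      fun_prop
    refine ((hc fun i => ((s i : ℕ) : ℝ)).continuousAt.eventually_lt
      (hc fun i => ((e₀ i : ℕ) : ℝ)).continuousAt ?_).filter_mono nhdsWithin_le_nhds
    simpa using hstrict s hs hse
  have h2 : ∀ p ∈ T, ∀ q ∈ T, p ≠ q → ∀ᶠ ε in 𝓝[≠] (0 : ℝ),
      ∑ i, (w₀ i + ε * u i) * ((p i : ℕ) : ℝ) ≠ ∑ i, (w₀ i + ε * u i) * ((q i : ℕ) : ℝ) := by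
    intro p hp q hq hpq
    have hup : ∑ i, u i * ((p i : ℕ) : ℝ) = ((p 0 : ℕ) : ℝ) + M * ((p 1 : ℕ) : ℝ) :=
      hu fun i => ((p i : ℕ) : ℝ)
    have huq : ∑ i, u i * ((q i : ℕ) : ℝ) = ((q 0 : ℕ) : ℝ) + M * ((q 1 : ℕ) : ℝ) :=
      hu fun i => ((q i : ℕ) : ℝ)
    have hb : (∑ i, u i * ((p i : ℕ) : ℝ)) - ∑ i, u i * ((q i : ℕ) : ℝ) ≠ 0 := by
      intro h
      refine hM p hp q hq hpq ?_
      linear_combination h - hup + huq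
    have key := eventually_affine_ne_zero (l := 𝓝[≠] (0 : ℝ)) eventually_ne_nhdsNE_zero
      (a := (∑ i, w₀ i * ((p i : ℕ) : ℝ)) - ∑ i, w₀ i * ((q i : ℕ) : ℝ))
      (b := (∑ i, u i * ((p i : ℕ) : ℝ)) - ∑ i, u i * ((q i : ℕ) : ℝ)) fun h => absurd h hb
    refine key.mono fun ε hε heq => hε ?_
    rw [hdecomp, hdecomp] at heq
    linear_combination heq
  have key : ∀ᶠ ε in 𝓝[≠] (0 : ℝ),
      (∀ s ∈ S, s ≠ e₀ →
        ∑ i, (w₀ i + ε * u i) * ((s i : ℕ) : ℝ) < ∑ i, (w₀ i + ε * u i) * ((e₀ i : ℕ) : ℝ)) ∧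
      (∀ p ∈ T, ∀ q ∈ T, p ≠ q →
        ∑ i, (w₀ i + ε * u i) * ((p i : ℕ) : ℝ) ≠ ∑ i, (w₀ i + ε * u i) * ((q i : ℕ) : ℝ)) := by
    refine Filter.Eventually.and ?_ ?_
    · simp only [Filter.eventually_all_finset, Filter.eventually_imp_distrib_left]
      exact h1
    · simp only [Filter.eventually_all_finset, Filter.eventually_imp_distrib_left]
      exact h2
  obtain ⟨ε, hε1, hε2⟩ := key.exists
  refine ⟨fun i => w₀ i + ε * u i, e₀, he₀S', rfl, hε1, ?_⟩
  intro p hp q hq hpq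
  by_contra hne
  exact hε2 p hp q hq hne hpq

end Summit.ValiantsHypothesis.ValiantsHypothesis.Theorems.NewtonUnitEquationsDissociatedUniform

end
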